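import Summits.BirchSwinnertonDyer.BirchSwinnertonDyer.Theorems.UniversalToricDescentLocalH1Transfer
import Summits.BirchSwinnertonDyer.BirchSwinnertonDyer.Theorems.UniversalToricDescentFrobeniusReduction
import Summits.BirchSwinnertonDyer.BirchSwinnertonDyer.Theorems.UniversalToricDescentCoinvariantLocalLemmas
import HarnessLib

/-!
# Route UniversalToricDescent — Greenberg–Vatsal Prop. (2.4) for a module with UNIPOTENT inertia:
# `#H¹(K_{∞,w}, A)[p] = #{x ∈ A/(τ−1)A : p x = 0, ρ(φ^{p^R}) x = q_v^{p^R} x}`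

Lead prover bsd-wall-utd-p1 g9 (`--supports stmt-BirchSwinnertonDyer-20399`). Sequel of
`UniversalToricDescentLocalH1Transfer` (`H¹(Hi, A) ⥲ H¹(I ∩ Hi, A)^{Hi}`, `Hi = Gal(K̄_v/K_{∞,w})`,
`I = I_{K_v}`), of `UniversalToricDescentCoinvariantLocalLemmas`, and of the Literature evaluation
`H¹(I_{K_v}, A) ≃ A ⧸ (ρ τ − 1)A` at a tame `p`-generator `τ` with its Frobenius rule
`q_v • ē(φ·c) = ρ̄(φ) ē(c)` (`TameInertiaCoinvariantsEvaluationProofs`), for a discrete `p`-primary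
`ℤ_p[Γ_{K_v}]`-module `A` with finite `A[p^k]` on which inertia acts with pointwise `p`-power order (the
Tate-curve situation `A = E[p^∞]`, `v` multiplicative):

* **`exists_forall_natCard_invariants_pTorsion_eq`** — Frobenius reduction: there is `R₀` with, for
  `R ≥ R₀`, `#{c ∈ H¹(I, A) : Hi·c = c, p c = 0} = #{x ∈ A ⧸ (ρ τ − 1)A : p x = 0, ρ̄(φ^{p^R}) x = q_v^{p^R} x}`
  (`I` acts trivially on `H¹(I, A)`; the classes killed by `p` have a common open normal stabiliser; `Hi`
  is generated by `I`, an open normal subgroup and `φ^{p^R}` — `exists_forall_localSubgroup_le_iff_pow_mem`;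
  and `q^{n} ē(φ^{n}·c) = ρ̄(φ^n) ē(c)` with `q` invertible on the `p`-primary quotient).
* **`exists_forall_natCard_pTorsion_subgroupH1_localSubgroup_eq_coinvariants`** — with the currency
  change and the transfer file: **`#H¹(Hi, A)[p] = #{x ∈ A ⧸ (ρ τ − 1)A : p x = 0, ρ̄(φ^{p^R}) x = q_v^{p^R} x}`**.

THEOREMS ONLY; no definition, no named fact, no `sorry`. BSD is not advanced by this file.
References: [GreenbergVatsal2000] §2 Prop. (2.4) and proof (arXiv p. 22); [GreenbergLNM1716] §3 Lemma 3.3;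
[SerreInventiones1972] §1.8 Prop. 6; [SerreLocalFields1979] XIII §1 Prop. 1.
-/

set_option autoImplicit false
-- `…BirchSwinnertonDyer.BirchSwinnertonDyer.Theorems…` is the problem's mandated namespace (D-0017).
set_option linter.dupNamespace false

noncomputable section

open scoped Classical

namespace Summit.BirchSwinnertonDyer.BirchSwinnertonDyer.Theorems.UniversalToricDescentCoinvariantLocalCount

open NumberField IsDedekindDomain Field ValuativeRel
open Literature.NumberTheory.EllipticCurves Literature.NumberTheory.GaloisRepresentations
  Literature.NumberTheory.GaloisRepresentations.IsNonarchimedeanLocalField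
  IsDedekindDomain.HeightOneSpectrum ContinuousCohomology CategoryTheory Topology
  Summit.BirchSwinnertonDyer.BirchSwinnertonDyer.Theorems.UniversalToricDescentProPrimeToP
  Summit.BirchSwinnertonDyer.BirchSwinnertonDyer.Theorems.UniversalToricDescentLocalH1Count
  Summit.BirchSwinnertonDyer.BirchSwinnertonDyer.Theorems.UniversalToricDescentLocalH1Transfer
  Summit.BirchSwinnertonDyer.BirchSwinnertonDyer.Theorems.UniversalToricDescentFrobeniusReduction
  Summit.BirchSwinnertonDyer.BirchSwinnertonDyer.Theorems.UniversalToricDescentCoinvariantLocalLemmas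

/-! ### Frobenius reduction over the `ℤ_p`-extension -/

section Frobenius

variable {K : Type} [Field K] [NumberField K] {v : HeightOneSpectrum (𝓞 K)} {p : ℕ} [Fact p.Prime]
  (κ : ZpExtension K p)
variable {A : Type} [AddCommGroup A] [Module ℤ_[p] A] [TopologicalSpace A] [DiscreteTopology A]
  [ContinuousSMul ℤ_[p] A]

/-- **Frobenius reduction for the coinvariant evaluation.** Let `κ` be ANY `ℤ_p`-extension of the number
field `K`, `v ∤ p` a place not split completely in `K_∞` (`hns`), `Hi = Gal(K̄_v/K_{∞,w})`, `I = I_{K_v}`,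
`ρ` a continuous `ℤ_p`-linear representation of `Γ_{K_v}` on a discrete `p`-primary `A` with finite
`A[p^k]` on which `I` acts with pointwise `p`-power order, `τ ∈ I` a tame `p`-generator with the evaluation
bijection `e : H¹(I, A) ≃ A ⧸ (ρ τ − 1)A`, `[z] ↦ z(τ)` (Literature
`exists_continuousCohomology_absInertia_equiv_coinvariants`), the `p`-torsion of `A ⧸ (ρ τ − 1)A` finite,
and `φ` an arithmetic Frobenius. Then there is `R₀` such that for all `R ≥ R₀`:
**`#{c ∈ H¹(I, A) : h·c = c ∀ h ∈ Hi, p c = 0} = #{x ∈ A ⧸ (ρ τ − 1)A : p x = 0, ρ̄(φ^{p^R}) x = q_v^{p^R} x}`.**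
(`I` acts trivially on `H¹(I, A)`; the finitely many classes killed by `p` have a common open normal
stabiliser `N₀`; `Hi ≤ S ⟺ φ^{p^R} ∈ S` for subgroups `S ⊇ I, N₀` (`exists_forall_localSubgroup_le_iff_pow_mem`);
and `q^n • e(φ^n·c) = ρ̄(φ^n) e(c)` with `q` invertible on the `p`-primary quotient.) This is
Greenberg–Vatsal's "`H¹((ℚ_∞)_η, A) = (A_{I_ℓ}/(ε_ℓ−1))(−1)^{⟨γ_η'⟩}`".
[cite: GreenbergVatsal2000, §2 Prop. (2.4) and proof (arXiv p. 22)]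
[cite: SerreInventiones1972, §1.8 Prop. 6] [cite: GreenbergLNM1716, §3 Lemma 3.3] -/
theorem exists_forall_natCard_invariants_pTorsion_eq (hpv : (p : 𝓞 K) ∉ v.asIdeal)
    (hns : ∃ σ : absoluteGaloisGroup (v.adicCompletion K),
      σ ∉ localSubgroup κ.kerSubgroup (v.adicCompletion K))
    (ρ : ContinuousRep (absoluteGaloisGroup (v.adicCompletion K)) ℤ_[p] A)
    (hA : ∀ a : A, ∃ k : ℕ, p ^ k • a = 0) (hfin : ∀ k : ℕ, Set.Finite {a : A | p ^ k • a = 0})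
    (hP : ∀ σ ∈ absInertia (v.adicCompletion K), ∀ a : A, ∃ k : ℕ, ((ρ σ) ^ p ^ k) a = a)
    {τ : ↥(absInertia (v.adicCompletion K))}
    (hτ : ∀ (B : Type) [Group B] [TopologicalSpace B] [DiscreteTopology B], IsPGroup p B →
        ∀ f : ↥(absInertia (v.adicCompletion K)) →* B, Continuous f →
          f.range = Subgroup.zpowers (f τ))
    (e : continuousCohomology 1 (subgroupRep ρ.toTopRep (absInertia (v.adicCompletion K))) ≃ₗ[ℤ_[p]]
        (A ⧸ LinearMap.range (ρ (τ : absoluteGaloisGroup (v.adicCompletion K)) - 1)))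
    (he : ∀ z, e (oneCocycleClass _ z) = Submodule.Quotient.mk (z.1 τ))
    (hfinQ : Set.Finite {x : A ⧸ LinearMap.range
        (ρ (τ : absoluteGaloisGroup (v.adicCompletion K)) - 1) | p • x = 0})
    {φ : absoluteGaloisGroup (v.adicCompletion K)} (hφ : IsFrobPow φ 1) :
    ∃ R₀ : ℕ, ∀ R : ℕ, R₀ ≤ R →
      Nat.card {c : continuousCohomology 1 (subgroupRep ρ.toTopRep (absInertia (v.adicCompletion K))) //
          (∀ h : absoluteGaloisGroup (v.adicCompletion K),
              h ∈ localSubgroup κ.kerSubgroup (v.adicCompletion K) →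
            conjMap ρ.toTopRep (absInertia (v.adicCompletion K)) h 1 c = c) ∧ p • c = 0} =
        Nat.card {x : A ⧸ LinearMap.range (ρ (τ : absoluteGaloisGroup (v.adicCompletion K)) - 1) //
          p • x = 0 ∧ Submodule.mapQ _ _ (ρ (φ ^ p ^ R))
              (range_sub_one_le_comap (v.adicCompletion K) ρ hA hfin hP hτ (φ ^ p ^ R)) x =
            (residueFieldCard (v.adicCompletion K) ^ p ^ R) • x} := by
  -- notation
  let Fv := v.adicCompletion K
  let G : Type := absoluteGaloisGroup Fv
  let Hi : Subgroup G := localSubgroup κ.kerSubgroup Fv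
  let I : Subgroup G := absInertia Fv
  let Y : TopRep ℤ_[p] G := ρ.toTopRep
  let YI : TopRep ℤ_[p] I := subgroupRep Y I
  haveI : CharZero Fv := charZero_of_injective_algebraMap (algebraMap K Fv).injective
  haveI := absoluteGaloisGroup_compactSpace Fv
  have hp : (p : ℕ).Prime := Fact.out
  have hℓ : ringChar 𝓀[Fv] ≠ p := v.ringChar_residueField_adicCompletion_ne hpv
  -- `q` is prime to `p`; the quotient is `p`-primary
  have hq : (residueFieldCard Fv).Coprime p := by
    obtain ⟨f, -, hf⟩ := residueFieldCard_eq_pow_ringChar (F := Fv)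
    rw [hf]
    exact ((Nat.coprime_primes (ringChar_residueField_prime (F := Fv)) hp).2 hℓ).pow_left f
  have hQp : ∀ x : A ⧸ LinearMap.range (ρ (τ : G) - 1), ∃ k : ℕ, p ^ k • x = 0 := fun x ↦ by
    obtain ⟨a, rfl⟩ := Submodule.Quotient.mk_surjective _ x
    obtain ⟨k, hk⟩ := hA a
    exact ⟨k, by rw [← Submodule.mkQ_apply, ← map_nsmul, hk, map_zero]⟩
  -- the classes killed by `p` form a finite set; a common open normal stabiliser
  have hT : Finite {c : continuousCohomology 1 YI // p • c = 0} := by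
    haveI : Finite {x : A ⧸ LinearMap.range (ρ (τ : G) - 1) // p • x = 0} := hfinQ.to_subtype
    refine Finite.of_injective (fun c : {c : continuousCohomology 1 YI // p • c = 0} ↦
      (⟨e c.1, by rw [← map_nsmul, c.2, map_zero]⟩ :
        {x : A ⧸ LinearMap.range (ρ (τ : G) - 1) // p • x = 0})) ?_
    intro c c' h
    exact Subtype.ext (e.injective (congrArg Subtype.val h))
  obtain ⟨N₀, hN₀⟩ := exists_openNormalSubgroup_forall_conjMap_eq ρ hT
  -- Frobenius reduction
  obtain ⟨R₀, hR₀⟩ :=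
    exists_forall_localSubgroup_le_iff_pow_mem κ hpv hns hφ N₀.toSubgroup N₀.isOpen'
  refine ⟨R₀, fun R hR ↦ ?_⟩
  -- the equivalence of the two conditions on a class killed by `p`
  have hchain : ∀ c : continuousCohomology 1 YI, p • c = 0 →
      ((∀ h : G, h ∈ Hi → conjMap Y I h 1 c = c) ↔
        Submodule.mapQ _ _ (ρ (φ ^ p ^ R)) (range_sub_one_le_comap Fv ρ hA hfin hP hτ (φ ^ p ^ R))
          (e c) = (residueFieldCard Fv ^ p ^ R) • e c) := by
    intro c hpc
    obtain ⟨S, hIS, hS⟩ := exists_subgroup_mem_iff_conjMap_eq ρ c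
    have h2 : Hi ≤ S ↔ φ ^ p ^ R ∈ S :=
      hR₀ R hR S hIS fun g hg ↦ (hS g).mpr (hN₀ c hpc g hg)
    have hit := pow_residueFieldCard_nsmul_equiv_conjMap_pow ρ hℓ hA hfin hP hτ hφ e he (p ^ R) c
    constructor
    · intro h
      have hφS := (hS (φ ^ p ^ R)).mp (h2.mp fun g hg ↦ (hS g).mpr (h g hg))
      rw [hφS] at hit
      exact hit.symm
    · intro h g hg
      have key := eq_of_pow_nsmul_eq_of_coprime hq hQp (p ^ R) _ _ (hit.trans h)
      exact (hS g).mp (h2.mpr ((hS (φ ^ p ^ R)).mpr (e.injective key)) hg)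
  -- count
  refine Nat.card_congr (e.toEquiv.subtypeEquiv fun c ↦ ?_)
  show (∀ h : G, h ∈ Hi → conjMap Y I h 1 c = c) ∧ p • c = 0 ↔
    p • e c = 0 ∧ Submodule.mapQ _ _ (ρ (φ ^ p ^ R))
      (range_sub_one_le_comap Fv ρ hA hfin hP hτ (φ ^ p ^ R)) (e c) = (residueFieldCard Fv ^ p ^ R) • e c
  constructor
  · rintro ⟨hc, hpc⟩
    exact ⟨by rw [← map_nsmul, hpc, map_zero], (hchain c hpc).mp hc⟩
  · rintro ⟨hpe, hx⟩
    have hpc : p • c = 0 := e.injective (by rw [map_nsmul, hpe, map_zero])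
    exact ⟨(hchain c hpc).mpr hx, hpc⟩

/-- **`#H¹(Hi, A)[p] = #{x ∈ A ⧸ (ρ τ − 1)A : p x = 0, ρ̄(φ^{p^R}) x = q_v^{p^R} x}`** for `R ≥ R₀`
(`Hi = Gal(K̄_v/K_{∞,w})`, hypotheses as in `exists_forall_natCard_invariants_pTorsion_eq`, with the
discrete `Γ_{K_v}`-module structure of `A` given by `ρ`): the transfer `H¹(Hi, A) ⥲ H¹(I ∩ Hi, A)^{Hi}`
(`UniversalToricDescentLocalH1Transfer`), the change of currency of §1, and the Frobenius reduction of §2.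
This is the local term of Greenberg–Vatsal (2.4) for a module with unipotent inertia, e.g. `E[p^∞]` at a
place of multiplicative reduction. [cite: GreenbergVatsal2000, §2 Prop. (2.4) and proof (arXiv p. 22)]
[cite: GreenbergLNM1716, §3 Lemma 3.3] -/
theorem exists_forall_natCard_pTorsion_subgroupH1_localSubgroup_eq_coinvariants
    (hpv : (p : 𝓞 K) ∉ v.asIdeal)
    (hns : ∃ σ : absoluteGaloisGroup (v.adicCompletion K),
      σ ∉ localSubgroup κ.kerSubgroup (v.adicCompletion K))
    [DistribMulAction (absoluteGaloisGroup (v.adicCompletion K)) A]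
    (ρ : ContinuousRep (absoluteGaloisGroup (v.adicCompletion K)) ℤ_[p] A)
    (hρ : ∀ (g : absoluteGaloisGroup (v.adicCompletion K)) (a : A), ρ g a = g • a)
    (hA : ∀ a : A, ∃ k : ℕ, p ^ k • a = 0) (hfin : ∀ k : ℕ, Set.Finite {a : A | p ^ k • a = 0})
    (hP : ∀ σ ∈ absInertia (v.adicCompletion K), ∀ a : A, ∃ k : ℕ, ((ρ σ) ^ p ^ k) a = a)
    {τ : ↥(absInertia (v.adicCompletion K))}
    (hτ : ∀ (B : Type) [Group B] [TopologicalSpace B] [DiscreteTopology B], IsPGroup p B →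
        ∀ f : ↥(absInertia (v.adicCompletion K)) →* B, Continuous f →
          f.range = Subgroup.zpowers (f τ))
    (e : continuousCohomology 1 (subgroupRep ρ.toTopRep (absInertia (v.adicCompletion K))) ≃ₗ[ℤ_[p]]
        (A ⧸ LinearMap.range (ρ (τ : absoluteGaloisGroup (v.adicCompletion K)) - 1)))
    (he : ∀ z, e (oneCocycleClass _ z) = Submodule.Quotient.mk (z.1 τ))
    (hfinQ : Set.Finite {x : A ⧸ LinearMap.range
        (ρ (τ : absoluteGaloisGroup (v.adicCompletion K)) - 1) | p • x = 0})
    {φ : absoluteGaloisGroup (v.adicCompletion K)} (hφ : IsFrobPow φ 1) :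
    ∃ R₀ : ℕ, ∀ R : ℕ, R₀ ≤ R →
      Nat.card {f : Literature.NumberTheory.EllipticCurves.subgroupH1
          (localSubgroup κ.kerSubgroup (v.adicCompletion K)) A // p • f = 0} =
        Nat.card {x : A ⧸ LinearMap.range (ρ (τ : absoluteGaloisGroup (v.adicCompletion K)) - 1) //
          p • x = 0 ∧ Submodule.mapQ _ _ (ρ (φ ^ p ^ R))
              (range_sub_one_le_comap (v.adicCompletion K) ρ hA hfin hP hτ (φ ^ p ^ R)) x =
            (residueFieldCard (v.adicCompletion K) ^ p ^ R) • x} := by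
  have hcont : ∀ a : A, Continuous fun g : absoluteGaloisGroup (v.adicCompletion K) ↦ g • a := fun a ↦ by
    have h : (fun g : absoluteGaloisGroup (v.adicCompletion K) ↦ g • a) = fun g ↦ ρ g a :=
      funext fun g ↦ (hρ g a).symm
    rw [h]
    exact ρ.continuous_smul.comp (continuous_id.prodMk continuous_const)
  obtain ⟨R₀, hR₀⟩ := exists_forall_natCard_invariants_pTorsion_eq κ hpv hns ρ hA hfin hP hτ e he hfinQ hφ
  refine ⟨R₀, fun R hR ↦ ?_⟩
  rw [natCard_pTorsion_subgroupH1_localSubgroup_eq κ hpv hns hA hcont,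
    natCard_invariants_pTorsion_eq_of_rep (absInertia (v.adicCompletion K))
      (localSubgroup κ.kerSubgroup (v.adicCompletion K)) (absInertia_le_localSubgroup κ hpv) ρ hρ,
    hR₀ R hR]

end Frobenius

end Summit.BirchSwinnertonDyer.BirchSwinnertonDyer.Theorems.UniversalToricDescentCoinvariantLocalCount

end
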